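import Summits.HodgeConjecture.HodgeConjecture.Theorems.F0P3cStCharTSWeylHypMeasure     -- ★ p849733: `exists_conjFamily` (generic: the conjugation family of an abelian subgroup)
import Literature.MeasureTheory.Group.ConjugationWeylVanishing                             -- ★ generic engine: `polishSpace_quotient_prod_subgroup`; via imports `exists_isOpen_injOn_conjFamily`, `measurableSet_image_inter_of_locallyInjOn`
import Literature.NumberTheory.Rogawski1990.LocalTransfer                                   -- ★ `IsLocalGRegular` (the `G`-regular predicate on `H_v = U(Φ₂)(L⁺_v) × U(Φ₁)(L⁺_v)`)
import HarnessLib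

/-!
# F0 · P3c · ROAD «UP-TR» (H3e) «COVER»: the `T`-regular sets of a system of Cartan subgroups PARTITION the regular set — GENERIC in `(G, R, T)`, and at the
# endoscopic group `H_v = U(Φ₂)(L⁺_v) × U(Φ₁)(L⁺_v)` with `R = {G-regular}` (Rogawski 1990 §12.5 p. 182 «the sum is over a set of representatives for the conjugacy classes
# of Cartan subgroups», applied on `H` at p. 183 ∕ Lemma 12.5.1; Harish-Chandra 1970 Lemma 42)

Cell `pub/hodgecm-mathlib`, crux H413 = `stmt-HodgeConjecture-24833` (lane `--supports`, helper; count-neutral); seat F0P3a-p02 (g24); ROAD «UP-TR» (LEAD T14-21, holder F0P3-p02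
(g23), road file `ROAD-UP-TR.v1` f07fd8df) brick **(H3e) COVER-H**.  THEOREMS ONLY; sorry-free; no definition ∕ instance ∕ notation ∕ named fact; ★-only imports; axioms TRIO.

THE POINT.  ★ (E2a) `F0P3cStCharTSWeylCartanCover` proves, for `G = U(Φ₃)(L⁺_v)` and `R = {regular semisimple}`, that the `T`-regular sets `G_T = {g t g⁻¹ | t ∈ T ∩ R}` of a
system `S` of representatives of the Cartan classes are pairwise disjoint, cover `R`, and hence `∫⁻_R f dν = Σ_{T ∈ S} ∫⁻_{G_T} f dν` (and `= ∫⁻_G f dν` when `Rᶜ` is `ν`-null)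
— the OUTER SUM of the Weyl integration formula.  Its proof uses exactly two facts about `(G, R)`: `R` is conjugation-invariant, and `Z(t) = T` for `t ∈ T ∩ R` («Cartan»
subgroups are the centralisers of their regular elements) — plus, for the Borel-measurability of `G_T`, the ★ generic engine (`T` closed abelian with `[N(T):T] ≠ 0`, `R` Borel;
Lusin–Souslin).  The UP-TRANSFER identity [Rogawski1990 §12.5 p. 183, L. 12.5.1] needs the same formula on the ENDOSCOPIC group `H_v = U(Φ₂)(L⁺_v) × U(Φ₁)(L⁺_v)` with
`R = {s | IsLocalGRegular L v s}` (`G`-regularity, ★ `LocalTransfer` :581).  This file types the cover ONCE for any group `G`, regular set `R ⊆ G` and subgroups `T` in the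
letters of ★ `Literature.MeasureTheory.Group.ConjugationWeylVanishing` (`hRc`, `hRT`, `hT`, `hTc`, `hW`, `hRm`), §1–§3, and instantiates it at `H_v` in §4 with the (H3a)(H3b)(H2)
facts of the road as hypotheses BY SHAPE (`G`-regularity conjugation-invariant and open; `Z_H(γ₀)` closed abelian, self-centralising at its `G`-regular elements, of finite Weyl
index; the `G`-singular set `νHv`-null).  The `T`-regular set is written INLINE `{x | ∃ g t, t ∈ T ∧ t ∈ R ∧ g * t * g⁻¹ = x}` (at `H_v`: `… ∧ IsLocalGRegular L v t ∧ …`), as ★ (E2a) does.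

* §1 `G_T`: elements of `T ∩ R` lie in it; it is contained in `R` (`hRc`); conjugation-invariant; DEPENDS ONLY ON THE CONJUGACY CLASS of `T` (`cartanSet_eq_of_forall_mem_iff`).
* §2 «Cartan» `T` (`hRT`): `γ ∈ G_{Z(γ)}`; `γ ∈ G_T` for `T` conjugate to `Z(γ)`; **meeting `T`-regular sets force conjugate `T`'s**; **non-conjugate ⇒ disjoint**.
* §3 a finite family `S` meeting every `Z(γ)`, `γ ∈ R`, up to conjugacy: **`⋃_{T ∈ S} G_T = R`**; `G_T` is Borel (engine); **`∫⁻_R f dν = Σ_{T ∈ S} ∫⁻_{G_T} f dν`** for `S` pairwise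
  non-conjugate; **`∫⁻_G f dν = Σ_{T ∈ S} ∫⁻_{G_T} f dν`** if `ν {g | g ∉ R} = 0`.
* §4 the same three integral statements on `H_v` with `R = {IsLocalGRegular L v}` and `T = Z_H(γ_T)` (letters of the road file §2), hypotheses (H3a)(H3b)(H2) by shape.
HONEST LABEL: count-neutral structure for the `H`-side Weyl integration formula (H5) of ROAD «UP-TR»; closes no organ; block consequents 11 → 10 → 9 only at the rider editions;
organs 2 = 2; h413 registry untouched.  HC_CM is proved only modulo the printed citations (2 remaining named inputs: hLiu418 = `stmt-HodgeConjecture-24832`, h413 =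
`stmt-HodgeConjecture-24833`) until rung 0 closes.

## References
* [Rogawski1990] J. D. Rogawski, *Automorphic Representations of Unitary Groups in Three Variables*, Ann. of Math. Stud. 123 (1990), §12.5 pp. 182–183, Lemma 12.5.1; §3.6 pp. 28–31.
* [HarishChandra1970] Harish-Chandra, *Harmonic analysis on reductive p-adic groups*, LNM 162 (1970), Lemma 42.
* [Federer1969] H. Federer, *Geometric Measure Theory* (1969), §2.10.10 (Lusin–Souslin).
-/

set_option autoImplicit false
-- the mandated namespace has the single-problem summit's repeated segment (`HodgeConjecture.HodgeConjecture`)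
set_option linter.dupNamespace false

noncomputable section

open MeasureTheory Measure Set Filter Topology Function NumberField IsDedekindDomain
open Literature.MeasureTheory.Group
open Literature.NumberTheory.Automorphic Literature.NumberTheory.Rogawski1990
open scoped ENNReal NNReal MatrixGroups Pointwise

namespace Summit.HodgeConjecture.HodgeConjecture.Cruxes.H413.F0P3cStCharTSUpTrCover

/-! ## §1 The `T`-regular set `G_T = {g t g⁻¹ | t ∈ T ∩ R}` of a subgroup `T` (any group `G`, any regular set `R`) -/

section Generic

variable {G : Type*} [Group G] {R : Set G}

/-- An element of `T ∩ R` lies in `G_T` (`g = 1`). [cite: Rogawski1990, §12.5 p. 182] -/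
theorem mem_cartanSet_of_mem {T : Subgroup G} {t : G} (ht : t ∈ T) (hreg : t ∈ R) :
    t ∈ {x | ∃ g t : G, t ∈ T ∧ t ∈ R ∧ g * t * g⁻¹ = x} :=
  ⟨1, t, ht, hreg, by rw [one_mul, inv_one, mul_one]⟩

/-- `G_T ⊆ R` when `R` is conjugation-invariant. [cite: Rogawski1990, §12.5 p. 182] -/
theorem mem_of_mem_cartanSet (hRc : ∀ g x : G, x ∈ R → g * x * g⁻¹ ∈ R) {T : Subgroup G} {x : G}
    (hx : x ∈ {x | ∃ g t : G, t ∈ T ∧ t ∈ R ∧ g * t * g⁻¹ = x}) : x ∈ R := by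
  obtain ⟨g, t, -, ht, rfl⟩ := hx
  exact hRc g t ht

/-- `G_T` is conjugation-invariant. [cite: Rogawski1990, §12.5 p. 182] -/
theorem conj_mem_cartanSet {T : Subgroup G} {x : G} (y : G) (hx : x ∈ {x | ∃ g t : G, t ∈ T ∧ t ∈ R ∧ g * t * g⁻¹ = x}) :
    y * x * y⁻¹ ∈ {x | ∃ g t : G, t ∈ T ∧ t ∈ R ∧ g * t * g⁻¹ = x} := by
  obtain ⟨g, t, htT, ht, rfl⟩ := hx
  exact ⟨y * g, t, htT, ht, by group⟩

/-- **`G_T` depends only on the conjugacy class of `T`**: if `T′ = x T x⁻¹` (`∀ g, g ∈ T′ ↔ x⁻¹ g x ∈ T`, the tree's conjugacy idiom ★ `F0P3cStCharTSCartanReps`) then `G_{T′} = G_T`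
(`R` conjugation-invariant). [cite: Rogawski1990, §12.5 p. 182] -/
theorem cartanSet_eq_of_forall_mem_iff (hRc : ∀ g x : G, x ∈ R → g * x * g⁻¹ ∈ R) {T T' : Subgroup G} {x : G} (h : ∀ g : G, g ∈ T' ↔ x⁻¹ * g * x ∈ T) :
    {y | ∃ g t : G, t ∈ T' ∧ t ∈ R ∧ g * t * g⁻¹ = y} = {y | ∃ g t : G, t ∈ T ∧ t ∈ R ∧ g * t * g⁻¹ = y} := by
  ext y
  constructor
  · rintro ⟨g, t, htT', ht, rfl⟩
    refine ⟨g * x, x⁻¹ * t * x, (h t).1 htT', ?_, by group⟩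
    have e : x⁻¹ * t * x = x⁻¹ * t * x⁻¹⁻¹ := by rw [inv_inv]
    rw [e]; exact hRc x⁻¹ t ht
  · rintro ⟨g, t, htT, ht, rfl⟩
    refine ⟨g * x⁻¹, x * t * x⁻¹, (h _).2 ?_, hRc x t ht, by group⟩
    have e : x⁻¹ * (x * t * x⁻¹) * x = t := by group
    rw [e]; exact htT

/-! ## §2 «Cartan» subgroups: `Z(t) = T` on `T ∩ R`; `γ ∈ G_{Z(γ)}`; meeting `T`-regular sets force conjugate subgroups -/

/-- The centraliser of a conjugate: `g ∈ Z(x t x⁻¹) ↔ x⁻¹ g x ∈ Z(t)`. [cite: Rogawski1990, §3.1 p. 19] -/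
theorem mem_centralizer_conj_iff (x t g : G) :
    g ∈ Subgroup.centralizer ({x * t * x⁻¹} : Set G) ↔ x⁻¹ * g * x ∈ Subgroup.centralizer ({t} : Set G) := by
  rw [Subgroup.mem_centralizer_singleton_iff, Subgroup.mem_centralizer_singleton_iff]
  constructor
  · intro h
    calc x⁻¹ * g * x * t = x⁻¹ * (g * (x * t * x⁻¹)) * x := by group
      _ = x⁻¹ * (x * t * x⁻¹ * g) * x := by rw [h]
      _ = t * (x⁻¹ * g * x) := by group
  · intro h
    calc g * (x * t * x⁻¹) = x * (x⁻¹ * g * x * t) * x⁻¹ := by group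
      _ = x * (t * (x⁻¹ * g * x)) * x⁻¹ := by rw [h]
      _ = x * t * x⁻¹ * g := by group

/-- **`γ ∈ R` lies in `G_{Z(γ)}`.** [cite: Rogawski1990, §12.5 p. 182; §3.6 p. 28] -/
theorem mem_cartanSet_centralizer_self {γ : G} (hγ : γ ∈ R) :
    γ ∈ {x | ∃ g t : G, t ∈ Subgroup.centralizer ({γ} : Set G) ∧ t ∈ R ∧ g * t * g⁻¹ = x} :=
  mem_cartanSet_of_mem (Subgroup.mem_centralizer_singleton_iff.2 rfl) hγ

/-- **`γ ∈ R` lies in `G_T` for every `T` conjugate to `Z(γ)`** (`∀ g, g ∈ Z(γ) ↔ x⁻¹ g x ∈ T` — the covering clause of ★ `exists_normalised_cartan_family` ∕ ★ `exists_cartanAll`).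
[cite: Rogawski1990, §12.5 p. 182; §3.6 p. 28] -/
theorem mem_cartanSet_of_forall_mem_iff (hRc : ∀ g x : G, x ∈ R → g * x * g⁻¹ ∈ R) {γ : G} (hγ : γ ∈ R) {T : Subgroup G} {x : G}
    (h : ∀ g : G, g ∈ Subgroup.centralizer ({γ} : Set G) ↔ x⁻¹ * g * x ∈ T) :
    γ ∈ {y | ∃ g t : G, t ∈ T ∧ t ∈ R ∧ g * t * g⁻¹ = y} := by
  rw [← cartanSet_eq_of_forall_mem_iff hRc h]
  exact mem_cartanSet_centralizer_self hγ

/-- **If `G_T` and `G_{T′}` MEET, for «Cartan» subgroups `T`, `T′` (each the centraliser of each of its `R`-elements: the engine letter `hRT`), then `T′` is conjugate to `T`**: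
a common element `g t g⁻¹ = g′ t′ g′⁻¹` (`t ∈ T ∩ R`, `t′ ∈ T′ ∩ R`) has `Z(t) = T`, `Z(t′) = T′`, and `t′ = y t y⁻¹` with `y = g′⁻¹ g`, so `∀ h, h ∈ T′ ↔ y⁻¹ h y ∈ T`.
[cite: Rogawski1990, §3.6 p. 28; §12.5 p. 182] -/
theorem exists_forall_mem_iff_of_mem_cartanSet_of_mem_cartanSet {T T' : Subgroup G}
    (hRT : ∀ t : ↥T, (t : G) ∈ R → Subgroup.centralizer ({(t : G)} : Set G) = T)
    (hRT' : ∀ t : ↥T', (t : G) ∈ R → Subgroup.centralizer ({(t : G)} : Set G) = T') {x : G}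
    (hx : x ∈ {y | ∃ g t : G, t ∈ T ∧ t ∈ R ∧ g * t * g⁻¹ = y}) (hx' : x ∈ {y | ∃ g t : G, t ∈ T' ∧ t ∈ R ∧ g * t * g⁻¹ = y}) :
    ∃ y : G, ∀ h : G, h ∈ T' ↔ y⁻¹ * h * y ∈ T := by
  obtain ⟨g, t, htT, ht, rfl⟩ := hx
  obtain ⟨g', t', ht'T', ht', heq⟩ := hx'
  have hZt : Subgroup.centralizer ({t} : Set G) = T := hRT ⟨t, htT⟩ ht
  have hZt' : Subgroup.centralizer ({t'} : Set G) = T' := hRT' ⟨t', ht'T'⟩ ht'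
  have ht'eq : t' = (g'⁻¹ * g) * t * (g'⁻¹ * g)⁻¹ := by
    calc t' = g'⁻¹ * (g' * t' * g'⁻¹) * g' := by group
      _ = g'⁻¹ * (g * t * g⁻¹) * g' := by rw [heq]
      _ = (g'⁻¹ * g) * t * (g'⁻¹ * g)⁻¹ := by group
  refine ⟨g'⁻¹ * g, fun h => ?_⟩
  rw [← hZt', ← hZt, ht'eq]
  exact mem_centralizer_conj_iff (g'⁻¹ * g) t h

/-- **Non-conjugate «Cartan» subgroups have DISJOINT `T`-regular sets.** [cite: Rogawski1990, §12.5 p. 182; §3.6 p. 28] -/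
theorem disjoint_cartanSet_of_not_conj {T T' : Subgroup G}
    (hRT : ∀ t : ↥T, (t : G) ∈ R → Subgroup.centralizer ({(t : G)} : Set G) = T)
    (hRT' : ∀ t : ↥T', (t : G) ∈ R → Subgroup.centralizer ({(t : G)} : Set G) = T')
    (hnc : ∀ y : G, ¬ ∀ h : G, h ∈ T' ↔ y⁻¹ * h * y ∈ T) :
    Disjoint {y | ∃ g t : G, t ∈ T ∧ t ∈ R ∧ g * t * g⁻¹ = y} {y | ∃ g t : G, t ∈ T' ∧ t ∈ R ∧ g * t * g⁻¹ = y} := by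
  rw [Set.disjoint_left]
  intro x hx hx'
  obtain ⟨y, hy⟩ := exists_forall_mem_iff_of_mem_cartanSet_of_mem_cartanSet hRT hRT' hx hx'
  exact hnc y hy

/-! ## §3 A system of representatives: the `G_T` cover `R` disjointly; `G_T` is Borel; the outer sum of the Weyl integration formula -/

/-- **THE `T`-REGULAR SETS OF A COVERING FAMILY EXHAUST `R`**: if `R` is conjugation-invariant and every `Z(γ)` (`γ ∈ R`) is conjugate to a member of `S`, then `⋃_{T ∈ S} G_T = R`.
[cite: Rogawski1990, §12.5 p. 182; §3.6 pp. 28–31] -/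
theorem biUnion_cartanSet_eq (hRc : ∀ g x : G, x ∈ R → g * x * g⁻¹ ∈ R) (S : Finset (Subgroup G))
    (hcov : ∀ γ : G, γ ∈ R → ∃ T ∈ S, ∃ x : G, ∀ g : G, g ∈ Subgroup.centralizer ({γ} : Set G) ↔ x⁻¹ * g * x ∈ T) :
    (⋃ T ∈ S, {y | ∃ g t : G, t ∈ T ∧ t ∈ R ∧ g * t * g⁻¹ = y}) = R := by
  ext y
  simp only [Set.mem_iUnion, exists_prop]
  constructor
  · rintro ⟨T, -, hy⟩
    exact mem_of_mem_cartanSet hRc hy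
  · intro hy
    obtain ⟨T, hTS, x, hx⟩ := hcov y hy
    exact ⟨T, hTS, mem_cartanSet_of_forall_mem_iff hRc hy hx⟩

/-- **The `T`-regular set is the image of the `R`-part of `G ⧸ T × T` under the conjugation family**: `Φ '' {p | ↑p.2 ∈ R} = G_T` (the engine's spelling on the left).
[cite: HarishChandra1970, Lemma 42] -/
theorem image_conjFamily_eq {T : Subgroup G} (Φ : (G ⧸ T) × ↥T → G) (hΦ : ∀ (x : G) (t : ↥T), Φ (QuotientGroup.mk x, t) = x * t * x⁻¹) :
    Φ '' {p : (G ⧸ T) × ↥T | ((p.2 : ↥T) : G) ∈ R} = {x | ∃ g t : G, t ∈ T ∧ t ∈ R ∧ g * t * g⁻¹ = x} := by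
  ext x
  constructor
  · rintro ⟨⟨q, t⟩, ht, rfl⟩
    obtain ⟨g, rfl⟩ := QuotientGroup.mk_surjective q
    exact ⟨g, t, t.2, ht, (hΦ g t).symm⟩
  · rintro ⟨g, t, htT, ht, rfl⟩
    exact ⟨(QuotientGroup.mk g, ⟨t, htT⟩), ht, hΦ g ⟨t, htT⟩⟩

/-- **`G_T` is BOREL** for a closed abelian `T` with `[N(T):T] ≠ 0` which is the centraliser of each of its `R`-elements, `R` Borel, in a locally compact second-countable Hausdorff
group (Lusin–Souslin: the conjugation family is continuous and locally injective on the Borel `R`-part of the Polish space `G⧸T × T`, ★ `exists_isOpen_injOn_conjFamily` + ★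
`measurableSet_image_inter_of_locallyInjOn`; the family itself ★ `exists_conjFamily`). [cite: Federer1969, §2.10.10] [cite: HarishChandra1970, Lemma 42] -/
theorem measurableSet_cartanSet [TopologicalSpace G] [IsTopologicalGroup G] [LocallyCompactSpace G] [SecondCountableTopology G] [T2Space G]
    [MeasurableSpace G] [BorelSpace G] {T : Subgroup G} (hT : IsClosed (T : Set G)) (hTc : ∀ a ∈ T, ∀ b ∈ T, a * b = b * a)
    (hRm : MeasurableSet R) (hRT : ∀ t : ↥T, (t : G) ∈ R → Subgroup.centralizer ({(t : G)} : Set G) = T)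
    (hW : (T.subgroupOf (Subgroup.normalizer (T : Set G))).index ≠ 0) :
    MeasurableSet {x | ∃ g t : G, t ∈ T ∧ t ∈ R ∧ g * t * g⁻¹ = x} := by
  classical
  obtain ⟨Φ, hΦ⟩ := F0P3cStCharTSWeylHypMeasure.exists_conjFamily T hTc
  letI : MeasurableSpace (G ⧸ T) := borel _
  haveI : BorelSpace (G ⧸ T) := ⟨rfl⟩
  haveI : PolishSpace ((G ⧸ T) × ↥T) := polishSpace_quotient_prod_subgroup T hT
  have hΦc : Continuous Φ := (continuous_conjFamily_and_smul T Φ hΦ).1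
  haveI : SecondCountableTopology ↥T := TopologicalSpace.Subtype.secondCountableTopology _
  haveI : BorelSpace ((G ⧸ T) × ↥T) := Prod.borelSpace
  have hD₀ : MeasurableSet {p : (G ⧸ T) × ↥T | ((p.2 : ↥T) : G) ∈ R} :=
    hRm.preimage (continuous_subtype_val.measurable.comp measurable_snd)
  have hinj : ∀ z ∈ {p : (G ⧸ T) × ↥T | ((p.2 : ↥T) : G) ∈ R}, ∃ U : Set ((G ⧸ T) × ↥T), IsOpen U ∧ z ∈ U ∧
      InjOn Φ (U ∩ {p : (G ⧸ T) × ↥T | ((p.2 : ↥T) : G) ∈ R}) := fun z _ =>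
    exists_isOpen_injOn_conjFamily T hT hTc Φ hΦ R hRT hW z
  rw [← image_conjFamily_eq Φ hΦ, ← Set.univ_inter {p : (G ⧸ T) × ↥T | ((p.2 : ↥T) : G) ∈ R}]
  exact measurableSet_image_inter_of_locallyInjOn hD₀ hΦc hinj MeasurableSet.univ

/-- **THE OUTER SUM OF THE WEYL INTEGRATION FORMULA ON `R`, measurability by hypothesis**: for a finite family `S` of «Cartan» subgroups (`hRT`), pairwise non-conjugate and
meeting every `Z(γ)`, `γ ∈ R`, up to conjugacy, with every `G_T` measurable, and any measure `ν`: `∫⁻_R f dν = Σ_{T ∈ S} ∫⁻_{G_T} f dν` for every `f : G → ℝ≥0∞`.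
[cite: Rogawski1990, §12.5 p. 182] [cite: HarishChandra1970, Lemma 42] -/
theorem lintegral_eq_sum_cartanSet_of_measurableSet [MeasurableSpace G] (hRc : ∀ g x : G, x ∈ R → g * x * g⁻¹ ∈ R) (S : Finset (Subgroup G))
    (hRT : ∀ T ∈ S, ∀ t : ↥T, (t : G) ∈ R → Subgroup.centralizer ({(t : G)} : Set G) = T)
    (hcov : ∀ γ : G, γ ∈ R → ∃ T ∈ S, ∃ x : G, ∀ g : G, g ∈ Subgroup.centralizer ({γ} : Set G) ↔ x⁻¹ * g * x ∈ T)
    (hnc : ∀ T ∈ S, ∀ T' ∈ S, T ≠ T' → ∀ y : G, ¬ ∀ h : G, h ∈ T' ↔ y⁻¹ * h * y ∈ T)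
    (hmeas : ∀ T ∈ S, MeasurableSet {y | ∃ g t : G, t ∈ T ∧ t ∈ R ∧ g * t * g⁻¹ = y}) (ν : Measure G) (f : G → ℝ≥0∞) :
    ∫⁻ y in R, f y ∂ν = ∑ T ∈ S, ∫⁻ y in {y | ∃ g t : G, t ∈ T ∧ t ∈ R ∧ g * t * g⁻¹ = y}, f y ∂ν := by
  classical
  conv_lhs => rw [← biUnion_cartanSet_eq hRc S hcov]
  refine lintegral_biUnion_finset ?_ hmeas f
  intro T hT T' hT' hne
  exact disjoint_cartanSet_of_not_conj (hRT T hT) (hRT T' hT') (hnc T hT T' hT' hne)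

/-- **THE OUTER SUM OF THE WEYL INTEGRATION FORMULA ON `R`** (topological form: `R` Borel, members of `S` closed abelian with `[N(T):T] ≠ 0`, so every `G_T` is Borel):
`∫⁻_R f dν = Σ_{T ∈ S} ∫⁻_{G_T} f dν`. [cite: Rogawski1990, §12.5 p. 182] [cite: HarishChandra1970, Lemma 42] -/
theorem lintegral_eq_sum_cartanSet [TopologicalSpace G] [IsTopologicalGroup G] [LocallyCompactSpace G] [SecondCountableTopology G] [T2Space G]
    [MeasurableSpace G] [BorelSpace G] (hRc : ∀ g x : G, x ∈ R → g * x * g⁻¹ ∈ R) (hRm : MeasurableSet R) (S : Finset (Subgroup G))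
    (hcl : ∀ T ∈ S, IsClosed (T : Set G)) (hab : ∀ T ∈ S, ∀ a ∈ T, ∀ b ∈ T, a * b = b * a)
    (hRT : ∀ T ∈ S, ∀ t : ↥T, (t : G) ∈ R → Subgroup.centralizer ({(t : G)} : Set G) = T)
    (hW : ∀ T ∈ S, (T.subgroupOf (Subgroup.normalizer (T : Set G))).index ≠ 0)
    (hcov : ∀ γ : G, γ ∈ R → ∃ T ∈ S, ∃ x : G, ∀ g : G, g ∈ Subgroup.centralizer ({γ} : Set G) ↔ x⁻¹ * g * x ∈ T)
    (hnc : ∀ T ∈ S, ∀ T' ∈ S, T ≠ T' → ∀ y : G, ¬ ∀ h : G, h ∈ T' ↔ y⁻¹ * h * y ∈ T)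
    (ν : Measure G) (f : G → ℝ≥0∞) :
    ∫⁻ y in R, f y ∂ν = ∑ T ∈ S, ∫⁻ y in {y | ∃ g t : G, t ∈ T ∧ t ∈ R ∧ g * t * g⁻¹ = y}, f y ∂ν :=
  lintegral_eq_sum_cartanSet_of_measurableSet hRc S hRT hcov hnc
    (fun T hT => measurableSet_cartanSet (hcl T hT) (hab T hT) hRm (hRT T hT) (hW T hT)) ν f

/-- **THE OUTER SUM OF THE WEYL INTEGRATION FORMULA**: as above, and IF `{g | g ∉ R}` is `ν`-null (print: «its complement has measure zero», [HarishChandra1970 L. 42]) then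
`∫⁻_G f dν = Σ_{T ∈ S} ∫⁻_{G_T} f dν`. [cite: Rogawski1990, §12.5 p. 182] [cite: HarishChandra1970, Lemma 42] -/
theorem lintegral_eq_sum_cartanSet_of_null [TopologicalSpace G] [IsTopologicalGroup G] [LocallyCompactSpace G] [SecondCountableTopology G] [T2Space G]
    [MeasurableSpace G] [BorelSpace G] (hRc : ∀ g x : G, x ∈ R → g * x * g⁻¹ ∈ R) (hRm : MeasurableSet R) (S : Finset (Subgroup G))
    (hcl : ∀ T ∈ S, IsClosed (T : Set G)) (hab : ∀ T ∈ S, ∀ a ∈ T, ∀ b ∈ T, a * b = b * a)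
    (hRT : ∀ T ∈ S, ∀ t : ↥T, (t : G) ∈ R → Subgroup.centralizer ({(t : G)} : Set G) = T)
    (hW : ∀ T ∈ S, (T.subgroupOf (Subgroup.normalizer (T : Set G))).index ≠ 0)
    (hcov : ∀ γ : G, γ ∈ R → ∃ T ∈ S, ∃ x : G, ∀ g : G, g ∈ Subgroup.centralizer ({γ} : Set G) ↔ x⁻¹ * g * x ∈ T)
    (hnc : ∀ T ∈ S, ∀ T' ∈ S, T ≠ T' → ∀ y : G, ¬ ∀ h : G, h ∈ T' ↔ y⁻¹ * h * y ∈ T)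
    (ν : Measure G) (hsing : ν {g : G | g ∉ R} = 0) (f : G → ℝ≥0∞) :
    ∫⁻ y, f y ∂ν = ∑ T ∈ S, ∫⁻ y in {y | ∃ g t : G, t ∈ T ∧ t ∈ R ∧ g * t * g⁻¹ = y}, f y ∂ν := by
  have hae : ∀ᵐ y ∂ν, y ∈ R := by
    rw [ae_iff]; exact hsing
  rw [← lintegral_eq_sum_cartanSet hRc hRm S hcl hab hRT hW hcov hnc ν f, Measure.restrict_eq_self_of_ae_mem hae]

end Generic

/-! ## §4 The endoscopic group `H_v = U(Φ₂)(L⁺_v) × U(Φ₁)(L⁺_v)` with `R = {G-regular}`: the outer sum of the `H`-side Weyl integration formula, (H3a)(H3b)(H2) by shape -/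

section Endoscopic

variable {L : Type} [Field L] [NumberField L] [IsCMField L] {v : HeightOneSpectrum (𝓞 ↥(maximalRealSubfield L))}
  -- (H3b) letters by shape: `G`-regularity is conjugation-invariant and open on `H_v`
  (hRc : ∀ g s : ((UnitaryGroup.cmDatum L 2 (Matrix.of fun i j : Fin 2 => if i.val + j.val + 1 = 2 then (1 : L) else 0)).Local v ×
      (UnitaryGroup.cmDatum L 1 (Matrix.of fun i j : Fin 1 => if i.val + j.val + 1 = 1 then (1 : L) else 0)).Local v),
    IsLocalGRegular L v s → IsLocalGRegular L v (g * s * g⁻¹))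
  (hRo : IsOpen {s : ((UnitaryGroup.cmDatum L 2 (Matrix.of fun i j : Fin 2 => if i.val + j.val + 1 = 2 then (1 : L) else 0)).Local v ×
      (UnitaryGroup.cmDatum L 1 (Matrix.of fun i j : Fin 1 => if i.val + j.val + 1 = 1 then (1 : L) else 0)).Local v) | IsLocalGRegular L v s})
  -- the family of Cartan subgroups `T = Z_H(γ_T)`, `γ_T` `G`-regular ((H1) CARTAN-ALL-H supplies it), with the (H3b)∕(H3a) letters per member by shape
  (S : Finset (Subgroup (((UnitaryGroup.cmDatum L 2 (Matrix.of fun i j : Fin 2 => if i.val + j.val + 1 = 2 then (1 : L) else 0)).Local v ×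
      (UnitaryGroup.cmDatum L 1 (Matrix.of fun i j : Fin 1 => if i.val + j.val + 1 = 1 then (1 : L) else 0)).Local v))))
  (hS : ∀ T ∈ S, ∃ γ : ((UnitaryGroup.cmDatum L 2 (Matrix.of fun i j : Fin 2 => if i.val + j.val + 1 = 2 then (1 : L) else 0)).Local v ×
      (UnitaryGroup.cmDatum L 1 (Matrix.of fun i j : Fin 1 => if i.val + j.val + 1 = 1 then (1 : L) else 0)).Local v),
    IsLocalGRegular L v γ ∧ T = Subgroup.centralizer ({γ} : Set _))
  (hab : ∀ T ∈ S, ∀ a ∈ T, ∀ b ∈ T, a * b = b * a)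
  (hZ : ∀ T ∈ S, ∀ t : ↥T, IsLocalGRegular L v (t : ((UnitaryGroup.cmDatum L 2 (Matrix.of fun i j : Fin 2 => if i.val + j.val + 1 = 2 then (1 : L) else 0)).Local v ×
      (UnitaryGroup.cmDatum L 1 (Matrix.of fun i j : Fin 1 => if i.val + j.val + 1 = 1 then (1 : L) else 0)).Local v)) →
    Subgroup.centralizer ({(t : ((UnitaryGroup.cmDatum L 2 (Matrix.of fun i j : Fin 2 => if i.val + j.val + 1 = 2 then (1 : L) else 0)).Local v ×
      (UnitaryGroup.cmDatum L 1 (Matrix.of fun i j : Fin 1 => if i.val + j.val + 1 = 1 then (1 : L) else 0)).Local v))} : Set _) = T)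
  (hW : ∀ T ∈ S, (T.subgroupOf (Subgroup.normalizer (T : Set (((UnitaryGroup.cmDatum L 2 (Matrix.of fun i j : Fin 2 => if i.val + j.val + 1 = 2 then (1 : L) else 0)).Local v ×
      (UnitaryGroup.cmDatum L 1 (Matrix.of fun i j : Fin 1 => if i.val + j.val + 1 = 1 then (1 : L) else 0)).Local v))))).index ≠ 0)
  (hcov : ∀ γ : ((UnitaryGroup.cmDatum L 2 (Matrix.of fun i j : Fin 2 => if i.val + j.val + 1 = 2 then (1 : L) else 0)).Local v ×
      (UnitaryGroup.cmDatum L 1 (Matrix.of fun i j : Fin 1 => if i.val + j.val + 1 = 1 then (1 : L) else 0)).Local v),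
    IsLocalGRegular L v γ → ∃ T ∈ S, ∃ x : ((UnitaryGroup.cmDatum L 2 (Matrix.of fun i j : Fin 2 => if i.val + j.val + 1 = 2 then (1 : L) else 0)).Local v ×
      (UnitaryGroup.cmDatum L 1 (Matrix.of fun i j : Fin 1 => if i.val + j.val + 1 = 1 then (1 : L) else 0)).Local v),
      ∀ g, g ∈ Subgroup.centralizer ({γ} : Set _) ↔ x⁻¹ * g * x ∈ T)
  (hnc : ∀ T ∈ S, ∀ T' ∈ S, T ≠ T' → ∀ y : ((UnitaryGroup.cmDatum L 2 (Matrix.of fun i j : Fin 2 => if i.val + j.val + 1 = 2 then (1 : L) else 0)).Local v ×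
      (UnitaryGroup.cmDatum L 1 (Matrix.of fun i j : Fin 1 => if i.val + j.val + 1 = 1 then (1 : L) else 0)).Local v),
    ¬ ∀ h, h ∈ T' ↔ y⁻¹ * h * y ∈ T)

include hRc in
/-- **(S-cov) letter of (H5), per Cartan**: a `G`-regular `γ ∈ H_v` lies in the `T`-regular set `H_T` of every `T` conjugate to `Z_H(γ)` (`∀ g, g ∈ Z_H(γ) ↔ x⁻¹ g x ∈ T`, the covering
clause of (H1) CARTAN-ALL-H) — §2 `mem_cartanSet_of_forall_mem_iff` at `H_v`, `R = {G-regular}`. [cite: Rogawski1990, §12.5 pp. 182–183] -/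
theorem mem_cartanSetH_of_forall_mem_iff {γ : ((UnitaryGroup.cmDatum L 2 (Matrix.of fun i j : Fin 2 => if i.val + j.val + 1 = 2 then (1 : L) else 0)).Local v ×
      (UnitaryGroup.cmDatum L 1 (Matrix.of fun i j : Fin 1 => if i.val + j.val + 1 = 1 then (1 : L) else 0)).Local v)} (hγ : IsLocalGRegular L v γ)
    {T : Subgroup (((UnitaryGroup.cmDatum L 2 (Matrix.of fun i j : Fin 2 => if i.val + j.val + 1 = 2 then (1 : L) else 0)).Local v ×
      (UnitaryGroup.cmDatum L 1 (Matrix.of fun i j : Fin 1 => if i.val + j.val + 1 = 1 then (1 : L) else 0)).Local v))} {x : ((UnitaryGroup.cmDatum L 2 (Matrix.of fun i j : Fin 2 => if i.val + j.val + 1 = 2 then (1 : L) else 0)).Local v ×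
      (UnitaryGroup.cmDatum L 1 (Matrix.of fun i j : Fin 1 => if i.val + j.val + 1 = 1 then (1 : L) else 0)).Local v)}
    (h : ∀ g, g ∈ Subgroup.centralizer ({γ} : Set _) ↔ x⁻¹ * g * x ∈ T) :
    γ ∈ {y | ∃ g s : ((UnitaryGroup.cmDatum L 2 (Matrix.of fun i j : Fin 2 => if i.val + j.val + 1 = 2 then (1 : L) else 0)).Local v ×
      (UnitaryGroup.cmDatum L 1 (Matrix.of fun i j : Fin 1 => if i.val + j.val + 1 = 1 then (1 : L) else 0)).Local v),
      s ∈ T ∧ IsLocalGRegular L v s ∧ g * s * g⁻¹ = y} :=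
  mem_cartanSet_of_forall_mem_iff (R := {s | IsLocalGRegular L v s}) (fun g x hx => hRc g x hx) hγ h

/-- **(S-disj) letter of (H5), per pair of Cartans**: if `T`, `T′ ≤ H_v` are each the centraliser of each of their `G`-regular elements ((H3b) `Z_H(t) = Z_H(γ₀)`, by shape) and NOT
conjugate (`∀ y, ¬ ∀ h, h ∈ T′ ↔ y⁻¹ h y ∈ T`, the irredundancy clause of (H1)), their `T`-regular sets are DISJOINT — §2 `disjoint_cartanSet_of_not_conj` at `H_v`.
[cite: Rogawski1990, §12.5 pp. 182–183; §3.6 p. 28] -/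
theorem disjoint_cartanSetH_of_not_conj {T T' : Subgroup (((UnitaryGroup.cmDatum L 2 (Matrix.of fun i j : Fin 2 => if i.val + j.val + 1 = 2 then (1 : L) else 0)).Local v ×
      (UnitaryGroup.cmDatum L 1 (Matrix.of fun i j : Fin 1 => if i.val + j.val + 1 = 1 then (1 : L) else 0)).Local v))}
    (hZT : ∀ t : ↥T, IsLocalGRegular L v (t : ((UnitaryGroup.cmDatum L 2 (Matrix.of fun i j : Fin 2 => if i.val + j.val + 1 = 2 then (1 : L) else 0)).Local v ×
      (UnitaryGroup.cmDatum L 1 (Matrix.of fun i j : Fin 1 => if i.val + j.val + 1 = 1 then (1 : L) else 0)).Local v)) →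
      Subgroup.centralizer ({(t : ((UnitaryGroup.cmDatum L 2 (Matrix.of fun i j : Fin 2 => if i.val + j.val + 1 = 2 then (1 : L) else 0)).Local v ×
      (UnitaryGroup.cmDatum L 1 (Matrix.of fun i j : Fin 1 => if i.val + j.val + 1 = 1 then (1 : L) else 0)).Local v))} : Set _) = T)
    (hZT' : ∀ t : ↥T', IsLocalGRegular L v (t : ((UnitaryGroup.cmDatum L 2 (Matrix.of fun i j : Fin 2 => if i.val + j.val + 1 = 2 then (1 : L) else 0)).Local v ×
      (UnitaryGroup.cmDatum L 1 (Matrix.of fun i j : Fin 1 => if i.val + j.val + 1 = 1 then (1 : L) else 0)).Local v)) →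
      Subgroup.centralizer ({(t : ((UnitaryGroup.cmDatum L 2 (Matrix.of fun i j : Fin 2 => if i.val + j.val + 1 = 2 then (1 : L) else 0)).Local v ×
      (UnitaryGroup.cmDatum L 1 (Matrix.of fun i j : Fin 1 => if i.val + j.val + 1 = 1 then (1 : L) else 0)).Local v))} : Set _) = T')
    (hnc : ∀ y : ((UnitaryGroup.cmDatum L 2 (Matrix.of fun i j : Fin 2 => if i.val + j.val + 1 = 2 then (1 : L) else 0)).Local v ×
      (UnitaryGroup.cmDatum L 1 (Matrix.of fun i j : Fin 1 => if i.val + j.val + 1 = 1 then (1 : L) else 0)).Local v),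
      ¬ ∀ h, h ∈ T' ↔ y⁻¹ * h * y ∈ T) :
    Disjoint {y | ∃ g s : ((UnitaryGroup.cmDatum L 2 (Matrix.of fun i j : Fin 2 => if i.val + j.val + 1 = 2 then (1 : L) else 0)).Local v ×
      (UnitaryGroup.cmDatum L 1 (Matrix.of fun i j : Fin 1 => if i.val + j.val + 1 = 1 then (1 : L) else 0)).Local v),
        s ∈ T ∧ IsLocalGRegular L v s ∧ g * s * g⁻¹ = y}
      {y | ∃ g s : ((UnitaryGroup.cmDatum L 2 (Matrix.of fun i j : Fin 2 => if i.val + j.val + 1 = 2 then (1 : L) else 0)).Local v ×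
      (UnitaryGroup.cmDatum L 1 (Matrix.of fun i j : Fin 1 => if i.val + j.val + 1 = 1 then (1 : L) else 0)).Local v),
        s ∈ T' ∧ IsLocalGRegular L v s ∧ g * s * g⁻¹ = y} :=
  disjoint_cartanSet_of_not_conj (R := {s | IsLocalGRegular L v s}) hZT hZT' hnc

variable
  [T2Space (((UnitaryGroup.cmDatum L 2 (Matrix.of fun i j : Fin 2 => if i.val + j.val + 1 = 2 then (1 : L) else 0)).Local v ×
    (UnitaryGroup.cmDatum L 1 (Matrix.of fun i j : Fin 1 => if i.val + j.val + 1 = 1 then (1 : L) else 0)).Local v))]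

include hS in
/-- The Cartan subgroups `Z_H(γ_T)` of the family are closed (Mathlib `Set.isClosed_centralizer`). [cite: Rogawski1990, §3.1 p. 19] -/
theorem isClosed_of_mem : ∀ T ∈ S, IsClosed (T : Set (((UnitaryGroup.cmDatum L 2 (Matrix.of fun i j : Fin 2 => if i.val + j.val + 1 = 2 then (1 : L) else 0)).Local v ×
    (UnitaryGroup.cmDatum L 1 (Matrix.of fun i j : Fin 1 => if i.val + j.val + 1 = 1 then (1 : L) else 0)).Local v))) := by
  intro T hT
  obtain ⟨γ, -, rfl⟩ := hS T hT
  exact Set.isClosed_centralizer _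

variable
  [MeasurableSpace (((UnitaryGroup.cmDatum L 2 (Matrix.of fun i j : Fin 2 => if i.val + j.val + 1 = 2 then (1 : L) else 0)).Local v ×
    (UnitaryGroup.cmDatum L 1 (Matrix.of fun i j : Fin 1 => if i.val + j.val + 1 = 1 then (1 : L) else 0)).Local v))]
  [BorelSpace (((UnitaryGroup.cmDatum L 2 (Matrix.of fun i j : Fin 2 => if i.val + j.val + 1 = 2 then (1 : L) else 0)).Local v ×
    (UnitaryGroup.cmDatum L 1 (Matrix.of fun i j : Fin 1 => if i.val + j.val + 1 = 1 then (1 : L) else 0)).Local v))]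
  [LocallyCompactSpace (((UnitaryGroup.cmDatum L 2 (Matrix.of fun i j : Fin 2 => if i.val + j.val + 1 = 2 then (1 : L) else 0)).Local v ×
    (UnitaryGroup.cmDatum L 1 (Matrix.of fun i j : Fin 1 => if i.val + j.val + 1 = 1 then (1 : L) else 0)).Local v))]
  [SecondCountableTopology (((UnitaryGroup.cmDatum L 2 (Matrix.of fun i j : Fin 2 => if i.val + j.val + 1 = 2 then (1 : L) else 0)).Local v ×
    (UnitaryGroup.cmDatum L 1 (Matrix.of fun i j : Fin 1 => if i.val + j.val + 1 = 1 then (1 : L) else 0)).Local v))]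
  (νHv : Measure (((UnitaryGroup.cmDatum L 2 (Matrix.of fun i j : Fin 2 => if i.val + j.val + 1 = 2 then (1 : L) else 0)).Local v ×
    (UnitaryGroup.cmDatum L 1 (Matrix.of fun i j : Fin 1 => if i.val + j.val + 1 = 1 then (1 : L) else 0)).Local v)))

include hRo hS hab hZ hW in
/-- **The `T`-regular set `H_T = {g s g⁻¹ | s ∈ T, s G-regular}` of a member `T = Z_H(γ_T)` is BOREL** (§3 `measurableSet_cartanSet` at `H_v`, `R = {G-regular}`).
[cite: Rogawski1990, §12.5 p. 183] [cite: Federer1969, §2.10.10] -/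
theorem measurableSet_cartanSetH : ∀ T ∈ S,
    MeasurableSet {x | ∃ g s : ((UnitaryGroup.cmDatum L 2 (Matrix.of fun i j : Fin 2 => if i.val + j.val + 1 = 2 then (1 : L) else 0)).Local v ×
        (UnitaryGroup.cmDatum L 1 (Matrix.of fun i j : Fin 1 => if i.val + j.val + 1 = 1 then (1 : L) else 0)).Local v),
      s ∈ T ∧ IsLocalGRegular L v s ∧ g * s * g⁻¹ = x} := by
  intro T hT
  exact measurableSet_cartanSet (R := {s | IsLocalGRegular L v s}) (isClosed_of_mem S hS T hT) (hab T hT) hRo.measurableSet (hZ T hT) (hW T hT)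

include hRc hRo hS hab hZ hW hcov hnc in
/-- **THE OUTER SUM OF THE `H`-SIDE WEYL INTEGRATION FORMULA ON THE `G`-REGULAR SET of `H_v = U(Φ₂)(L⁺_v) × U(Φ₁)(L⁺_v)`**: for a finite family `S` of Cartan subgroups `T = Z_H(γ_T)`
(`γ_T` `G`-regular), abelian and self-centralising at their `G`-regular elements, of finite Weyl index, pairwise non-conjugate and meeting every `Z_H(γ)` (`γ` `G`-regular) up to
conjugacy, and any measure `νHv`: `∫⁻_{G-reg} f dνHv = Σ_{T ∈ S} ∫⁻_{H_T} f dνHv`. [cite: Rogawski1990, §12.5 pp. 182–183, Lemma 12.5.1] [cite: HarishChandra1970, Lemma 42] -/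
theorem lintegral_setOf_isLocalGRegular_eq_sum_cartanSetH
    (f : ((UnitaryGroup.cmDatum L 2 (Matrix.of fun i j : Fin 2 => if i.val + j.val + 1 = 2 then (1 : L) else 0)).Local v ×
      (UnitaryGroup.cmDatum L 1 (Matrix.of fun i j : Fin 1 => if i.val + j.val + 1 = 1 then (1 : L) else 0)).Local v) → ℝ≥0∞) :
    ∫⁻ y in {s | IsLocalGRegular L v s}, f y ∂νHv =
      ∑ T ∈ S, ∫⁻ y in {x | ∃ g s : ((UnitaryGroup.cmDatum L 2 (Matrix.of fun i j : Fin 2 => if i.val + j.val + 1 = 2 then (1 : L) else 0)).Local v ×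
          (UnitaryGroup.cmDatum L 1 (Matrix.of fun i j : Fin 1 => if i.val + j.val + 1 = 1 then (1 : L) else 0)).Local v),
        s ∈ T ∧ IsLocalGRegular L v s ∧ g * s * g⁻¹ = x}, f y ∂νHv :=
  lintegral_eq_sum_cartanSet (R := {s | IsLocalGRegular L v s}) (fun g x hx => hRc g x hx) hRo.measurableSet S (isClosed_of_mem S hS) hab hZ hW
    (fun γ hγ => hcov γ hγ) hnc νHv f

include hRc hRo hS hab hZ hW hcov hnc in
/-- **THE OUTER SUM OF THE `H`-SIDE WEYL INTEGRATION FORMULA**: as above, and IF the `G`-singular set of `H_v` is `νHv`-null ((H2) SINGULAR-NULL-H, by shape) then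
`∫⁻_{H_v} f dνHv = Σ_{T ∈ S} ∫⁻_{H_T} f dνHv`. [cite: Rogawski1990, §12.5 pp. 182–183, Lemma 12.5.1] [cite: HarishChandra1970, Lemma 42] -/
theorem lintegral_eq_sum_cartanSetH_of_null
    (hsing : νHv {s | ¬ IsLocalGRegular L v s} = 0)
    (f : ((UnitaryGroup.cmDatum L 2 (Matrix.of fun i j : Fin 2 => if i.val + j.val + 1 = 2 then (1 : L) else 0)).Local v ×
      (UnitaryGroup.cmDatum L 1 (Matrix.of fun i j : Fin 1 => if i.val + j.val + 1 = 1 then (1 : L) else 0)).Local v) → ℝ≥0∞) :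
    ∫⁻ y, f y ∂νHv =
      ∑ T ∈ S, ∫⁻ y in {x | ∃ g s : ((UnitaryGroup.cmDatum L 2 (Matrix.of fun i j : Fin 2 => if i.val + j.val + 1 = 2 then (1 : L) else 0)).Local v ×
          (UnitaryGroup.cmDatum L 1 (Matrix.of fun i j : Fin 1 => if i.val + j.val + 1 = 1 then (1 : L) else 0)).Local v),
        s ∈ T ∧ IsLocalGRegular L v s ∧ g * s * g⁻¹ = x}, f y ∂νHv :=
  lintegral_eq_sum_cartanSet_of_null (R := {s | IsLocalGRegular L v s}) (fun g x hx => hRc g x hx) hRo.measurableSet S (isClosed_of_mem S hS) hab hZ hW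
    (fun γ hγ => hcov γ hγ) hnc νHv hsing f

end Endoscopic

end Summit.HodgeConjecture.HodgeConjecture.Cruxes.H413.F0P3cStCharTSUpTrCover
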